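import Mathlib.Algebra.Polynomial.Div
import Mathlib.RingTheory.AdicCompletion.Basic
import Mathlib.RingTheory.Polynomial.Basic
import Mathlib.RingTheory.Polynomial.Quotient
import Mathlib.Tactic.LinearCombination
import HarnessLib

/-!
# Hensel's lemma for factorisations over an adically complete ring

Topic `RingTheory/HenselLemma` (proofs only; no definitions, no named facts). Mathlib has
Hensel's lemma for ROOTS (`HenselianRing`, `IsAdicComplete.henselianRing`) and records the
lifting of coprime FACTORISATIONS as a TODO (`Mathlib/RingTheory/Henselian.lean`). This file
proves the factorisation form in the generality of Bourbaki, *Commutative Algebra* III §4 no. 3,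
Th. 1 (restricted to polynomials): the ring `A` is complete and Hausdorff for the `I`-adic
topology (`IsAdicComplete I A`), NOT assumed local or noetherian, and the polynomial `f` is NOT
assumed monic — only the factor `g₀` to be lifted is monic, and `g₀, h₀` are comaximal
("fortement étrangers") modulo `I`.

* `exists_monic_mul_eq` — **existence**: if `f ≡ g₀h₀ (mod I[X])`, `g₀` monic,
  `u g₀ + v h₀ ≡ 1 (mod I[X])`, then `f = g h` with `g` monic, `deg g = deg g₀`, `g ≡ g₀`,
  `h ≡ h₀ (mod I[X])`, `deg h ≤ deg f - deg g₀`;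
* `eq_of_monic_of_mul_eq` — **uniqueness** (over any `I`-adically Hausdorff ring): two such
  factorisations with monic first factors of the same degree coincide;
* `exists_monic_mul_eq_of_coeff_mem` — **adic Weierstrass preparation for polynomials**: if
  modulo `I` the polynomial `f` has degree `k` with unit leading coefficient, then `f = g h` with
  `g` monic of degree `k` and `h ≡ f_k (mod I[X])` (the case `h̄₀ =` unit constant; this is the
  "`p`-adic Weierstrass preparation theorem" by which Blakestad–Grant 2023, Prop. 7, split the
  `p`-division polynomial `φ_p(x) = φ_ψ(x)·ξ_ψ(x)` over the `p`-complete ring `R̂`, the step of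
  their construction of the Mazur–Tate sigma function that produces the quotient curve
  `E' = E/(canonical subgroup)`; vendored here for the discharge of the tree's named fact
  `WeierstrassCurve.mazur_tate_sigma_existsUnique`).

Ingredients: `coeff_mem_of_coeff_monic_mul_mem` (monic cancellation modulo an ideal above a
degree), `exists_next_approximation` (one step `mod Iⁿ⁺¹ ↦ mod Iⁿ⁺²`, Bourbaki's/Matsumura's:
with `Δ = f - GH`, divide `Δv` by `G`, correct `G` by the remainder and `H` by the truncated
cofactor), coefficientwise limits by `IsPrecomplete`, exactness of the limit by `IsHausdorff`.
"`p ∈ Iⁿ[X]`" is `p ∈ (I ^ n).map C` (Mathlib `Ideal.mem_map_C_iff`).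

## Sources

* N. Bourbaki, *Commutative Algebra*, Ch. III §4 no. 3, Th. 1 (Hensel) and its proof (steps 1–4;
  no. 1 Prop. 1 for the division step), and the remark "si R est un polynôme, il en est de même
  de Q". [Bourbaki1989CommAlg]
* H. Matsumura, *Commutative Ring Theory*, Thm. 8.3 (the local, monic case; the successive
  approximation followed here).
* C. Blakestad, D. Grant, J. Number Theory 249 (2023), Prop. 7 and its proof ("Applying the
  `p`-adic Weierstrass preparation theorem … `φ_p(x)` factors as … `φ_ψ(x)` … times a monic
  polynomial `ξ_ψ(x) ∈ R̂[x]`"), Lemma 12. [BlakestadGrant2023]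

## Design notes

* Degrees: with `d = deg g₀` and `e = deg f - d` (truncated subtraction) the approximants are
  kept of degrees `d` (monic) and `≤ e`, so that the limits are polynomials; the initial `h₀` is
  first truncated (`exists_cofactor_natDegree_le`: its coefficients above `e` lie in `I`).
* The trivial ring is allowed (then everything is `0`); `exists_monic_mul_eq_of_coeff_mem`
  assumes `Nontrivial A` because its conclusion `deg g = k` needs it.
* Pure proof file about Mathlib's `Polynomial.modByMonic`, `IsAdicComplete`; nothing is asserted.
-/

noncomputable section

open Polynomial

namespace Literature.RingTheory.HenselLemma

variable {A : Type*} [CommRing A]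

/-! ### Coefficients in an ideal -/

section CoeffIdeal

variable (N : Ideal A)

/-- `p ∈ N[X]` (all coefficients in `N`) iff `p` maps to `0` in `(A/N)[X]`. [folklore] -/
theorem map_mk_eq_zero_iff {p : A[X]} :
    p.map (Ideal.Quotient.mk N) = 0 ↔ ∀ i, p.coeff i ∈ N := by
  rw [Polynomial.ext_iff]
  refine forall_congr' fun i => ?_
  rw [coeff_map, coeff_zero, Ideal.Quotient.eq_zero_iff_mem]

/-- Division with remainder by a monic polynomial preserves `N[X]`: the remainder.
[folklore] -/
theorem coeff_modByMonic_mem {G p : A[X]} (hG : G.Monic) (hp : ∀ i, p.coeff i ∈ N) (i : ℕ) :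
    (p %ₘ G).coeff i ∈ N := by
  have h : (p %ₘ G).map (Ideal.Quotient.mk N) = 0 := by
    rw [map_modByMonic _ hG, (map_mk_eq_zero_iff N).mpr hp, zero_modByMonic]
  exact (map_mk_eq_zero_iff N).mp h i

/-- Division with remainder by a monic polynomial preserves `N[X]`: the quotient. [folklore] -/
theorem coeff_divByMonic_mem {G p : A[X]} (hG : G.Monic) (hp : ∀ i, p.coeff i ∈ N) (i : ℕ) :
    (p /ₘ G).coeff i ∈ N := by
  have h : (p /ₘ G).map (Ideal.Quotient.mk N) = 0 := by
    rw [map_divByMonic _ hG, (map_mk_eq_zero_iff N).mpr hp, zero_divByMonic]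
  exact (map_mk_eq_zero_iff N).mp h i

/-- **Monic cancellation modulo an ideal, above a degree.** If `G` is monic of degree `d` and
all coefficients of `G·V` of degree `≥ m + d` lie in `N`, then all coefficients of `V` of degree
`≥ m` lie in `N` (downward induction: `[X^{d+j}](GV) = Vⱼ + ∑_{b > j} G_{d+j-b} V_b`).
[folklore] -/
theorem coeff_mem_of_coeff_monic_mul_mem {G V : A[X]} (hG : G.Monic) (m : ℕ)
    (h : ∀ i, m + G.natDegree ≤ i → (G * V).coeff i ∈ N) : ∀ j, m ≤ j → V.coeff j ∈ N := by
  set d := G.natDegree with hd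
  -- downward induction, measured by `V.natDegree - j`
  suffices H : ∀ k j, V.natDegree < j + k → m ≤ j → V.coeff j ∈ N by
    intro j hj
    exact H (V.natDegree + 1) j (by omega) hj
  intro k
  induction k with
  | zero =>
    intro j hj _
    rw [coeff_eq_zero_of_natDegree_lt (by omega)]
    exact N.zero_mem
  | succ k ih =>
    intro j hj hmj
    -- the coefficient of `X^{d+j}` in `G V`
    have hcoeff : (G * V).coeff (d + j) = V.coeff j +
        ∑ x ∈ (Finset.antidiagonal (d + j)).filter (fun x => j < x.2),
          G.coeff x.1 * V.coeff x.2 := by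
      rw [coeff_mul, ← Finset.sum_filter_add_sum_filter_not _ (fun x : ℕ × ℕ => j < x.2)]
      rw [add_comm]
      congr 1
      rw [Finset.sum_eq_single (d, j)]
      · rw [show G.coeff d = 1 from hG.coeff_natDegree, one_mul]
      · rintro ⟨a, b⟩ hab hne
        rw [Finset.mem_filter, Finset.mem_antidiagonal] at hab
        obtain ⟨hab, hjb⟩ := hab
        have hb : b < j := lt_of_le_of_ne (not_lt.mp hjb) fun h => hne (by
          subst h; simp only [Prod.mk.injEq, and_true]; omega)
        have ha : d < a := by omega
        rw [coeff_eq_zero_of_natDegree_lt ha, zero_mul]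
      · intro h
        exfalso
        exact h (Finset.mem_filter.mpr ⟨Finset.mem_antidiagonal.mpr rfl, by simp⟩)
    have hsum : ∑ x ∈ (Finset.antidiagonal (d + j)).filter (fun x => j < x.2),
        G.coeff x.1 * V.coeff x.2 ∈ N := by
      refine N.sum_mem fun x hx => ?_
      rw [Finset.mem_filter, Finset.mem_antidiagonal] at hx
      exact N.mul_mem_left _ (ih x.2 (by omega) (by omega))
    have := h (d + j) (by omega)
    rw [hcoeff] at this
    have hV : V.coeff j = (V.coeff j + ∑ x ∈ (Finset.antidiagonal (d + j)).filter
        (fun x => j < x.2), G.coeff x.1 * V.coeff x.2) - ∑ x ∈ (Finset.antidiagonal (d + j)).filter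
        (fun x => j < x.2), G.coeff x.1 * V.coeff x.2 := by ring
    rw [hV]
    exact N.sub_mem this hsum

end CoeffIdeal

/-! ### Congruences modulo `Iⁿ[X]` -/

section Congruence

variable (I : Ideal A)

/-- `Iⁿ[X] · Iᵐ[X] ⊆ Iⁿ⁺ᵐ[X]`. [folklore] -/
theorem mul_mem_map_C_pow {n m : ℕ} {p q : A[X]} (hp : p ∈ (I ^ n).map (C : A →+* A[X]))
    (hq : q ∈ (I ^ m).map (C : A →+* A[X])) : p * q ∈ (I ^ (n + m)).map (C : A →+* A[X]) := by
  rw [pow_add, Ideal.map_mul]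
  exact Ideal.mul_mem_mul hp hq

/-- `Iᵐ[X] ⊆ Iⁿ[X]` for `n ≤ m`. [folklore] -/
theorem map_C_pow_le {n m : ℕ} (h : n ≤ m) :
    (I ^ m).map (C : A →+* A[X]) ≤ (I ^ n).map (C : A →+* A[X]) :=
  Ideal.map_mono (Ideal.pow_le_pow_right h)

/-- In a trivial ring every polynomial lies in every `Iⁿ[X]`. [folklore] -/
theorem mem_map_C_of_subsingleton [Subsingleton A] (J : Ideal A) (p : A[X]) :
    p ∈ J.map (C : A →+* A[X]) := by
  rw [Subsingleton.elim p 0]; exact Ideal.zero_mem _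

end Congruence

/-! ### The approximation step -/

section Step

variable (I : Ideal A)

/-- **One step of Hensel's approximation.** Data: `f`, a monic `g₀` of degree `d`, `h₀`, and
`u, v` with `u g₀ + v h₀ ≡ 1 (mod I)`; `e = deg f - d`. From an approximate factorisation
`f ≡ G H (mod Iⁿ⁺¹)` with `G ≡ g₀`, `H ≡ h₀ (mod I)`, `G` monic of degree `d`, `deg H ≤ e`, one
gets a better one `f ≡ G' H' (mod Iⁿ⁺²)` with `G' ≡ G`, `H' ≡ H (mod Iⁿ⁺¹)` and the same
degree constraints: with `Δ = f - GH`, write `Δ v = G q + W` (`deg W < d`), put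
`V = Δ u + H q`, truncate `V` in degrees `> e` (those coefficients lie in `Iⁿ⁺²`, by monic
cancellation), and set `G' = G + W`, `H' = H + V_{≤ e}`.
[cite: Bourbaki1989CommAlg, Ch. III §4 no. 3, proof of Th. 1] -/
theorem exists_next_approximation (f u v g₀ h₀ : A[X])
    (huv : u * g₀ + v * h₀ - 1 ∈ I.map (C : A →+* A[X])) {n : ℕ} {G H : A[X]} (hG : G.Monic)
    (hGdeg : G.natDegree = g₀.natDegree) (hHdeg : H.natDegree ≤ f.natDegree - g₀.natDegree)
    (hGg : G - g₀ ∈ I.map (C : A →+* A[X])) (hHh : H - h₀ ∈ I.map (C : A →+* A[X]))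
    (hf : f - G * H ∈ (I ^ (n + 1)).map (C : A →+* A[X])) :
    ∃ G' H' : A[X], G'.Monic ∧ G'.natDegree = g₀.natDegree ∧
      H'.natDegree ≤ f.natDegree - g₀.natDegree ∧
      G' - G ∈ (I ^ (n + 1)).map (C : A →+* A[X]) ∧ H' - H ∈ (I ^ (n + 1)).map (C : A →+* A[X]) ∧
      f - G' * H' ∈ (I ^ (n + 2)).map (C : A →+* A[X]) := by
  rcases subsingleton_or_nontrivial A with hA | hA
  · exact ⟨G, H, hG, hGdeg, hHdeg, mem_map_C_of_subsingleton _ _, mem_map_C_of_subsingleton _ _,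
      mem_map_C_of_subsingleton _ _⟩
  set d := g₀.natDegree with hd
  set e := f.natDegree - g₀.natDegree with he
  set Δ := f - G * H with hΔ
  set W := (Δ * v) %ₘ G with hW
  set q := (Δ * v) /ₘ G with hq
  set V := Δ * u + H * q with hV
  set Vt := V %ₘ (X ^ (e + 1)) with hVt
  have hXe : (X ^ (e + 1) : A[X]).Monic := monic_X_pow _
  -- coefficient ideals
  have hΔv : ∀ i, (Δ * v).coeff i ∈ I ^ (n + 1) :=
    Ideal.mem_map_C_iff.mp (Ideal.mul_mem_right _ _ hf)
  have hWc : ∀ i, W.coeff i ∈ I ^ (n + 1) := coeff_modByMonic_mem _ hG hΔv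
  have hqc : ∀ i, q.coeff i ∈ I ^ (n + 1) := coeff_divByMonic_mem _ hG hΔv
  have hWm : W ∈ (I ^ (n + 1)).map (C : A →+* A[X]) := Ideal.mem_map_C_iff.mpr hWc
  have hqm : q ∈ (I ^ (n + 1)).map (C : A →+* A[X]) := Ideal.mem_map_C_iff.mpr hqc
  have hVm : V ∈ (I ^ (n + 1)).map (C : A →+* A[X]) :=
    Ideal.add_mem _ (Ideal.mul_mem_right _ _ hf) (Ideal.mul_mem_left _ _ hqm)
  have hVc : ∀ i, V.coeff i ∈ I ^ (n + 1) := Ideal.mem_map_C_iff.mp hVm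
  have hVtc : ∀ i, Vt.coeff i ∈ I ^ (n + 1) := coeff_modByMonic_mem _ hXe hVc
  have hVtm : Vt ∈ (I ^ (n + 1)).map (C : A →+* A[X]) := Ideal.mem_map_C_iff.mpr hVtc
  -- degrees
  have hWdeg : W.degree < G.degree := degree_modByMonic_lt _ hG
  have hG' : (G + W).Monic := hG.add_of_left hWdeg
  have hG'deg : (G + W).natDegree = g₀.natDegree := by
    rw [natDegree_add_eq_left_of_degree_lt hWdeg, hGdeg]
  have hXne : (X ^ (e + 1) : A[X]) ≠ 1 := fun h => by
    have := congrArg natDegree h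
    rw [natDegree_X_pow, natDegree_one] at this
    exact Nat.succ_ne_zero e this
  have hVtdeg : Vt.natDegree ≤ e := Nat.lt_succ_iff.mp (by
    have := natDegree_modByMonic_lt V hXe hXne
    rwa [natDegree_X_pow] at this)
  have hH'deg : (H + Vt).natDegree ≤ f.natDegree - g₀.natDegree :=
    (natDegree_add_le _ _).trans (max_le hHdeg hVtdeg)
  -- Step A: `Δ - G V - H W = -Δ (uG + vH - 1) ∈ Iⁿ⁺²[X]`
  have hA : Δ - G * V - H * W ∈ (I ^ (n + 2)).map (C : A →+* A[X]) := by
    have hsplit : W + G * q = Δ * v := modByMonic_add_div _ _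
    have h1 : u * G + v * H - 1 ∈ (I ^ 1).map (C : A →+* A[X]) := by
      have : u * G + v * H - 1 = (u * g₀ + v * h₀ - 1) + u * (G - g₀) + v * (H - h₀) := by ring
      rw [pow_one, this]
      exact Ideal.add_mem _ (Ideal.add_mem _ huv (Ideal.mul_mem_left _ _ hGg))
        (Ideal.mul_mem_left _ _ hHh)
    have : Δ - G * V - H * W = -(Δ * (u * G + v * H - 1)) := by
      rw [hV, show H * W = H * (Δ * v) - H * (G * q) by rw [← hsplit]; ring]
      ring
    rw [this]
    exact neg_mem (mul_mem_map_C_pow (n := n + 1) (m := 1) I hf h1)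
  -- Step B: the coefficients of `V` above `e` lie in `Iⁿ⁺²`, so `G (V - Vt) ∈ Iⁿ⁺²[X]`
  have hde : f.natDegree ≤ d + e := by omega
  have hΔdeg : Δ.natDegree ≤ d + e := by
    refine (natDegree_sub_le _ _).trans (max_le hde ?_)
    refine natDegree_mul_le.trans ?_
    rw [hGdeg]; exact Nat.add_le_add_left hHdeg _
  have hHW : ∀ i, d + e + 1 ≤ i → (H * W).coeff i = 0 := by
    intro i hi
    by_cases hG1 : G = 1
    · have : W = 0 := by rw [hW, hG1, modByMonic_one]
      rw [this, mul_zero, coeff_zero]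
    · have hWnat : W.natDegree < d := by
        have hlt := natDegree_modByMonic_lt (Δ * v) hG hG1
        rw [← hW, hGdeg] at hlt
        exact hlt
      refine coeff_eq_zero_of_natDegree_lt (natDegree_mul_le.trans_lt ?_)
      omega
  have hGV : ∀ i, (e + 1) + G.natDegree ≤ i → (G * V).coeff i ∈ I ^ (n + 2) := by
    intro i hi
    rw [hGdeg] at hi
    have h1 : (G * V).coeff i = (Δ - H * W).coeff i - (Δ - G * V - H * W).coeff i := by
      simp only [coeff_sub]; ring
    rw [h1, coeff_sub, hHW i (by omega), coeff_eq_zero_of_natDegree_lt (by omega : Δ.natDegree < i),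
      zero_sub, neg_zero, zero_sub]
    exact neg_mem (Ideal.mem_map_C_iff.mp hA i)
  have hVhigh : ∀ j, e + 1 ≤ j → V.coeff j ∈ I ^ (n + 2) :=
    coeff_mem_of_coeff_monic_mul_mem _ hG (e + 1) hGV
  have hB : G * (V - Vt) ∈ (I ^ (n + 2)).map (C : A →+* A[X]) := by
    refine Ideal.mul_mem_left _ _ (Ideal.mem_map_C_iff.mpr fun j => ?_)
    have hdiv : Vt = V - X ^ (e + 1) * (V /ₘ X ^ (e + 1)) := modByMonic_eq_sub_mul_div _ _
    rw [hdiv, sub_sub_cancel, coeff_X_pow_mul']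
    split_ifs with hj
    · -- `j ≥ e + 1`: this coefficient is `V.coeff j - Vt.coeff j = V.coeff j`
      have hVt0 : Vt.coeff j = 0 := coeff_eq_zero_of_natDegree_lt (by omega)
      have : (V /ₘ X ^ (e + 1)).coeff (j - (e + 1)) = V.coeff j := by
        have := congrArg (fun P : A[X] => P.coeff j) hdiv
        simp only [coeff_sub, coeff_X_pow_mul', if_pos hj, hVt0] at this
        exact (sub_eq_zero.mp this.symm).symm
      rw [this]; exact hVhigh j hj
    · exact Submodule.zero_mem _
  -- Step C and assembly
  have hC : W * Vt ∈ (I ^ (n + 2)).map (C : A →+* A[X]) :=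
    map_C_pow_le I (by omega : n + 2 ≤ (n + 1) + (n + 1)) (mul_mem_map_C_pow I hWm hVtm)
  refine ⟨G + W, H + Vt, hG', hG'deg, hH'deg, by rw [add_sub_cancel_left]; exact hWm,
    by rw [add_sub_cancel_left]; exact hVtm, ?_⟩
  have : f - (G + W) * (H + Vt) = (Δ - G * V - H * W) + G * (V - Vt) - W * Vt := by
    rw [hΔ]; ring
  rw [this]
  exact Ideal.sub_mem _ (Ideal.add_mem _ hA hB) hC

end Step

/-! ### Truncation and coefficient bookkeeping -/

section Truncation

/-- The remainder modulo `Xᵏ` is the truncation below degree `k`. [folklore] -/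
theorem coeff_modByMonic_X_pow (V : A[X]) (k j : ℕ) :
    (V %ₘ X ^ k).coeff j = if j < k then V.coeff j else 0 := by
  rcases subsingleton_or_nontrivial A with hA | hA
  · split_ifs <;> exact Subsingleton.elim _ _
  rcases Nat.eq_zero_or_pos k with rfl | hk
  · rw [pow_zero, modByMonic_one, coeff_zero, if_neg (Nat.not_lt_zero j)]
  have hdiv : V %ₘ X ^ k = V - X ^ k * (V /ₘ X ^ k) := modByMonic_eq_sub_mul_div _ _
  split_ifs with hj
  · rw [hdiv, coeff_sub, coeff_X_pow_mul', if_neg (not_le.mpr hj), sub_zero]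
  · have hne : (X ^ k : A[X]) ≠ 1 := fun h => by
      have := congrArg natDegree h
      rw [natDegree_X_pow, natDegree_one] at this
      omega
    exact coeff_eq_zero_of_natDegree_lt
      ((natDegree_modByMonic_lt V (monic_X_pow k) hne).trans_le (by
        rw [natDegree_X_pow]; exact not_lt.mp hj))

/-- Coefficients of `∑_{i<N} Lᵢ Xⁱ`. [folklore] -/
theorem coeff_sum_C_mul_X_pow (L : ℕ → A) (N j : ℕ) :
    (∑ i ∈ Finset.range N, C (L i) * X ^ i).coeff j = if j < N then L j else 0 := by
  rw [finsetSum_coeff]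
  simp_rw [coeff_C_mul_X_pow]
  rw [Finset.sum_ite_eq]
  simp only [Finset.mem_range]

variable (I : Ideal A)

/-- **Truncating the initial cofactor.** If `f ≡ g₀h₀ (mod I)` with `g₀` monic of degree `d`
and `e = deg f - d` (truncated subtraction), the coefficients of `h₀` above `e` lie in `I`
(monic cancellation), so `h₀ mod X^{e+1}` is again a cofactor modulo `I`, of degree `≤ e`.
[folklore] -/
theorem exists_cofactor_natDegree_le (f g₀ h₀ : A[X]) (hg₀ : g₀.Monic)
    (hf : f - g₀ * h₀ ∈ I.map (C : A →+* A[X])) :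
    ∃ h₁ : A[X], h₁.natDegree ≤ f.natDegree - g₀.natDegree ∧ h₁ - h₀ ∈ I.map (C : A →+* A[X]) ∧
      f - g₀ * h₁ ∈ I.map (C : A →+* A[X]) := by
  set d := g₀.natDegree with hd
  set e := f.natDegree - g₀.natDegree with he
  have hhigh : ∀ j, e + 1 ≤ j → h₀.coeff j ∈ I := by
    refine coeff_mem_of_coeff_monic_mul_mem I hg₀ (e + 1) fun i hi => ?_
    have : (g₀ * h₀).coeff i = f.coeff i - (f - g₀ * h₀).coeff i := by rw [coeff_sub]; ring
    rw [this, coeff_eq_zero_of_natDegree_lt (by omega : f.natDegree < i), zero_sub]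
    exact neg_mem (Ideal.mem_map_C_iff.mp hf i)
  refine ⟨h₀ %ₘ X ^ (e + 1), ?_, ?_, ?_⟩
  · rw [natDegree_le_iff_coeff_eq_zero]
    intro j hj
    rw [coeff_modByMonic_X_pow, if_neg (by omega)]
  · refine Ideal.mem_map_C_iff.mpr fun j => ?_
    rw [coeff_sub, coeff_modByMonic_X_pow]
    split_ifs with hj
    · rw [sub_self]; exact I.zero_mem
    · rw [zero_sub]; exact neg_mem (hhigh j (by omega))
  · have : f - g₀ * (h₀ %ₘ X ^ (e + 1)) = (f - g₀ * h₀) - g₀ * (h₀ %ₘ X ^ (e + 1) - h₀) := by ring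
    rw [this]
    refine Ideal.sub_mem _ hf (Ideal.mul_mem_left _ _ (Ideal.mem_map_C_iff.mpr fun j => ?_))
    rw [coeff_sub, coeff_modByMonic_X_pow]
    split_ifs with hj
    · rw [sub_self]; exact I.zero_mem
    · rw [zero_sub]; exact neg_mem (hhigh j (by omega))

/-- `x ≡ y [SMOD J • ⊤]` in `A` means `x - y ∈ J`. [folklore] -/
theorem smodEq_smul_top_iff (J : Ideal A) (x y : A) :
    x ≡ y [SMOD (J • ⊤ : Submodule A A)] ↔ x - y ∈ J := by
  rw [SModEq.sub_mem, Ideal.smul_eq_mul, Ideal.mul_top]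

end Truncation

/-! ### Hensel's lemma for factorisations: existence -/

section Existence

variable (I : Ideal A) [IsAdicComplete I A]

/-- **Hensel's lemma for factorisations over an `I`-adically complete ring** (Bourbaki, *Comm.
Alg.* III §4 no. 3, Th. 1, for polynomials; the ring need not be local nor noetherian, `f` need
not be monic). Let `A` be `I`-adically complete (Hausdorff and complete), `f ∈ A[X]`, and
suppose `f ≡ g₀ h₀ (mod I)` with `g₀` MONIC and `g₀, h₀` comaximal modulo `I`
(`u g₀ + v h₀ ≡ 1 (mod I)` for some `u, v` — "fortement étrangers" in `(A/I)[X]`). Then there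
are `g, h ∈ A[X]` with `g` monic of the same degree as `g₀`, `g ≡ g₀`, `h ≡ h₀ (mod I)`,
`deg h ≤ deg f - deg g₀`, and `f = g h`. (Uniqueness: `eq_of_monic_of_mul_eq`.) Proof by
successive approximation (`exists_next_approximation`) and passage to the limit coefficientwise
(`IsPrecomplete`), the limit factorisation being exact by `IsHausdorff`.
[cite: Bourbaki1989CommAlg, Ch. III §4 no. 3, Th. 1] -/
theorem exists_monic_mul_eq (f u v g₀ h₀ : A[X]) (hg₀ : g₀.Monic)
    (hf : f - g₀ * h₀ ∈ I.map (C : A →+* A[X]))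
    (huv : u * g₀ + v * h₀ - 1 ∈ I.map (C : A →+* A[X])) :
    ∃ g h : A[X], g.Monic ∧ g.natDegree = g₀.natDegree ∧
      h.natDegree ≤ f.natDegree - g₀.natDegree ∧
      g - g₀ ∈ I.map (C : A →+* A[X]) ∧ h - h₀ ∈ I.map (C : A →+* A[X]) ∧ f = g * h := by
  set d := g₀.natDegree with hd
  set e := f.natDegree - g₀.natDegree with he
  obtain ⟨h₁, hh₁deg, hh₁, hf₁⟩ := exists_cofactor_natDegree_le I f g₀ h₀ hg₀ hf
  -- the invariant of the approximation and the step
  let P : ℕ → A[X] × A[X] → Prop := fun n GH => GH.1.Monic ∧ GH.1.natDegree = d ∧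
    GH.2.natDegree ≤ e ∧ GH.1 - g₀ ∈ I.map (C : A →+* A[X]) ∧
    GH.2 - h₀ ∈ I.map (C : A →+* A[X]) ∧ f - GH.1 * GH.2 ∈ (I ^ (n + 1)).map (C : A →+* A[X])
  have hP0 : P 0 (g₀, h₁) :=
    ⟨hg₀, rfl, hh₁deg, by rw [sub_self]; exact Ideal.zero_mem _, hh₁, by rwa [zero_add, pow_one]⟩
  have hstep : ∀ n (GH : A[X] × A[X]), P n GH → ∃ GH' : A[X] × A[X], P (n + 1) GH' ∧
      GH'.1 - GH.1 ∈ (I ^ (n + 1)).map (C : A →+* A[X]) ∧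
      GH'.2 - GH.2 ∈ (I ^ (n + 1)).map (C : A →+* A[X]) := by
    rintro n ⟨G, H⟩ ⟨hG, hGdeg, hHdeg, hGg, hHh, hfGH⟩
    obtain ⟨G', H', hG', hG'deg, hH'deg, hG'G, hH'H, hf'⟩ :=
      exists_next_approximation I f u v g₀ h₀ huv hG hGdeg hHdeg hGg hHh hfGH
    have h1 : (I ^ (n + 1)).map (C : A →+* A[X]) ≤ I.map (C : A →+* A[X]) := by
      conv_rhs => rw [← pow_one I]
      exact map_C_pow_le I (by omega)
    refine ⟨(G', H'), ⟨hG', hG'deg, hH'deg, ?_, ?_, hf'⟩, hG'G, hH'H⟩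
    · have : G' - g₀ = (G' - G) + (G - g₀) := by ring
      rw [this]; exact Ideal.add_mem _ (h1 hG'G) hGg
    · have : H' - h₀ = (H' - H) + (H - h₀) := by ring
      rw [this]; exact Ideal.add_mem _ (h1 hH'H) hHh
  -- the sequence of approximations
  let seq : (n : ℕ) → {GH : A[X] × A[X] // P n GH} := fun n =>
    Nat.rec (motive := fun n => {GH : A[X] × A[X] // P n GH}) ⟨(g₀, h₁), hP0⟩
      (fun n s => ⟨Classical.choose (hstep n s.1 s.2),
        (Classical.choose_spec (hstep n s.1 s.2)).1⟩) n
  have hseq : ∀ n, (seq (n + 1)).1.1 - (seq n).1.1 ∈ (I ^ (n + 1)).map (C : A →+* A[X]) ∧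
      (seq (n + 1)).1.2 - (seq n).1.2 ∈ (I ^ (n + 1)).map (C : A →+* A[X]) := fun n =>
    (Classical.choose_spec (hstep n (seq n).1 (seq n).2)).2
  set Gs : ℕ → A[X] := fun n => (seq n).1.1 with hGs
  set Hs : ℕ → A[X] := fun n => (seq n).1.2 with hHs
  have hPn : ∀ n, P n (Gs n, Hs n) := fun n => (seq n).2
  -- Cauchy property of the coefficients
  have hcauchy : ∀ (c : ℕ → A[X]), (∀ n, c (n + 1) - c n ∈ (I ^ (n + 1)).map (C : A →+* A[X])) →
      ∀ i m n, m ≤ n → (c n).coeff i - (c m).coeff i ∈ I ^ m := by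
    intro c hc i m n hmn
    induction n, hmn using Nat.le_induction with
    | base => rw [sub_self]; exact Ideal.zero_mem _
    | succ n hmn ih =>
      have : (c (n + 1)).coeff i - (c m).coeff i =
          ((c (n + 1)).coeff i - (c n).coeff i) + ((c n).coeff i - (c m).coeff i) := by ring
      rw [this]
      refine Ideal.add_mem _ (Ideal.pow_le_pow_right (by omega : m ≤ n + 1) ?_) ih
      rw [← coeff_sub]
      exact Ideal.mem_map_C_iff.mp (hc n) i
  have hlim : ∀ (c : ℕ → A[X]), (∀ n, c (n + 1) - c n ∈ (I ^ (n + 1)).map (C : A →+* A[X])) →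
      ∃ L : ℕ → A, ∀ i n, (c n).coeff i - L i ∈ I ^ n := by
    intro c hc
    have : ∀ i, ∃ L : A, ∀ n, (c n).coeff i - L ∈ I ^ n := by
      intro i
      obtain ⟨L, hL⟩ := IsPrecomplete.prec' (I := I) (fun n => (c n).coeff i) (fun {m n} hmn =>
        (smodEq_smul_top_iff _ _ _).mpr (by
          rw [← neg_sub]; exact neg_mem (hcauchy c hc i m n hmn)))
      exact ⟨L, fun n => (smodEq_smul_top_iff _ _ _).mp (hL n)⟩
    choose L hL using this
    exact ⟨L, hL⟩
  obtain ⟨LG, hLG⟩ := hlim Gs (fun n => (hseq n).1)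
  obtain ⟨LH, hLH⟩ := hlim Hs (fun n => (hseq n).2)
  -- the limits
  set g : A[X] := ∑ i ∈ Finset.range (d + 1), C (LG i) * X ^ i with hgdef
  set h : A[X] := ∑ i ∈ Finset.range (e + 1), C (LH i) * X ^ i with hhdef
  have hgG : ∀ n, g - Gs n ∈ (I ^ n).map (C : A →+* A[X]) := by
    intro n
    refine Ideal.mem_map_C_iff.mpr fun j => ?_
    rw [coeff_sub, hgdef, coeff_sum_C_mul_X_pow]
    split_ifs with hj
    · rw [← neg_sub]; exact neg_mem (hLG j n)
    · rw [coeff_eq_zero_of_natDegree_lt (by rw [(hPn n).2.1]; omega), sub_zero]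
      exact Ideal.zero_mem _
  have hhH : ∀ n, h - Hs n ∈ (I ^ n).map (C : A →+* A[X]) := by
    intro n
    refine Ideal.mem_map_C_iff.mpr fun j => ?_
    rw [coeff_sub, hhdef, coeff_sum_C_mul_X_pow]
    split_ifs with hj
    · rw [← neg_sub]; exact neg_mem (hLH j n)
    · rw [coeff_eq_zero_of_natDegree_lt (lt_of_le_of_lt (hPn n).2.2.1 (by omega)), sub_zero]
      exact Ideal.zero_mem _
  -- `f = g h`
  have hfgh : f = g * h := by
    rw [← sub_eq_zero]
    refine Polynomial.ext fun j => ?_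
    rw [coeff_zero]
    refine IsHausdorff.haus' (I := I) _ fun n => (smodEq_smul_top_iff _ _ _).mpr ?_
    rw [sub_zero]
    have : f - g * h = (f - Gs n * Hs n) - (g - Gs n) * Hs n - g * (h - Hs n) := by ring
    rw [this]
    refine Ideal.mem_map_C_iff.mp (Ideal.sub_mem _ (Ideal.sub_mem _ ?_
      (Ideal.mul_mem_right _ _ (hgG n))) (Ideal.mul_mem_left _ _ (hhH n))) j
    exact map_C_pow_le I (Nat.le_succ n) (hPn n).2.2.2.2.2
  -- `g` is monic of degree `d`
  have hgd : g.coeff d = 1 := by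
    rw [← sub_eq_zero]
    refine IsHausdorff.haus' (I := I) _ fun n => (smodEq_smul_top_iff _ _ _).mpr ?_
    rw [sub_zero]
    have h1 : (Gs n).coeff d = 1 := by
      have := (hPn n).1.coeff_natDegree; rwa [(hPn n).2.1] at this
    have := Ideal.mem_map_C_iff.mp (hgG n) d
    rwa [coeff_sub, h1] at this
  have hgle : g.natDegree ≤ d := by
    rw [natDegree_le_iff_coeff_eq_zero]
    intro j hj
    rw [hgdef, coeff_sum_C_mul_X_pow, if_neg (by omega)]
  have hgmonic : g.Monic := monic_of_natDegree_le_of_coeff_eq_one d hgle hgd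
  have hgnat : g.natDegree = g₀.natDegree := by
    rcases subsingleton_or_nontrivial A with hA | hA
    · rw [natDegree_of_subsingleton, natDegree_of_subsingleton]
    · exact le_antisymm hgle (le_natDegree_of_ne_zero (by rw [hgd]; exact one_ne_zero))
  have hhle : h.natDegree ≤ f.natDegree - g₀.natDegree := by
    rw [natDegree_le_iff_coeff_eq_zero]
    intro j hj
    rw [hhdef, coeff_sum_C_mul_X_pow, if_neg (by omega)]
  refine ⟨g, h, hgmonic, hgnat, hhle, ?_, ?_, hfgh⟩
  · have : g - g₀ = (g - Gs 1) + (Gs 1 - g₀) := by ring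
    rw [this]
    refine Ideal.add_mem _ ?_ (hPn 1).2.2.2.1
    have := hgG 1; rwa [pow_one] at this
  · have : h - h₀ = (h - Hs 1) + (Hs 1 - h₀) := by ring
    rw [this]
    refine Ideal.add_mem _ ?_ (hPn 1).2.2.2.2.1
    have := hhH 1; rwa [pow_one] at this

end Existence

/-! ### Hensel's lemma for factorisations: uniqueness -/

section Uniqueness

variable (I : Ideal A) [IsHausdorff I A]

/-- **Uniqueness in Hensel's lemma** (Bourbaki, *Comm. Alg.* III §4 no. 3, Th. 1: "il existe un
couple (P, Q) et un seul"). Over an `I`-adically Hausdorff ring: if `g h = g' h'` with `g, g'`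
monic of the same degree, `g' ≡ g`, `h' ≡ h (mod I)`, and `g, h` comaximal modulo `I`, then
`g = g'` and `h = h'`. Proof: by induction `g' - g, h' - h ∈ Iⁿ[X]` for all `n` (with
`δ = g' - g`, `ε = h' - h`: `gε + hδ = -δε`, `δ ≡ g(uδ - vε)` has degree `< deg g`, so
`δ ∈ Iⁿ⁺¹[X]` by monic cancellation, then `gε ∈ Iⁿ⁺¹[X]` gives `ε ∈ Iⁿ⁺¹[X]`).
[cite: Bourbaki1989CommAlg, Ch. III §4 no. 3, Th. 1] -/
theorem eq_of_monic_of_mul_eq (u v g h g' h' : A[X]) (hg : g.Monic) (hg' : g'.Monic)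
    (hdeg : g'.natDegree = g.natDegree)
    (huv : u * g + v * h - 1 ∈ I.map (C : A →+* A[X]))
    (hgg : g' - g ∈ I.map (C : A →+* A[X])) (hhh : h' - h ∈ I.map (C : A →+* A[X]))
    (hmul : g * h = g' * h') : g = g' ∧ h = h' := by
  set δ := g' - g with hδ
  set ε := h' - h with hε
  -- `deg δ < deg g`
  have hδdeg : ∀ i, g.natDegree ≤ i → δ.coeff i = 0 := by
    intro i hi
    rcases hi.lt_or_eq with hlt | heq
    · rw [hδ, coeff_sub, coeff_eq_zero_of_natDegree_lt (by omega),
        coeff_eq_zero_of_natDegree_lt hlt, sub_zero]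
    · rw [hδ, coeff_sub, ← heq]
      conv_lhs => rw [show g'.coeff g.natDegree = 1 by rw [← hdeg]; exact hg'.coeff_natDegree,
        hg.coeff_natDegree]
      exact sub_self 1
  -- induction on the exponent
  have key : ∀ n, δ ∈ (I ^ (n + 1)).map (C : A →+* A[X]) ∧
      ε ∈ (I ^ (n + 1)).map (C : A →+* A[X]) := by
    intro n
    induction n with
    | zero => rw [zero_add, pow_one]; exact ⟨hgg, hhh⟩
    | succ n ih =>
      obtain ⟨hδn, hεn⟩ := ih
      -- `g ε + h δ = -δ ε ∈ I^{n+2}[X]`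
      have hsum : g * ε + h * δ ∈ (I ^ (n + 2)).map (C : A →+* A[X]) := by
        have : g * ε + h * δ = -(δ * ε) := by
          have h0 : g' * h' - g * h = 0 := by rw [hmul, sub_self]
          have : g' * h' - g * h = g * ε + h * δ + δ * ε := by rw [hδ, hε]; ring
          rw [this] at h0
          linear_combination h0
        rw [this]
        exact neg_mem (map_C_pow_le I (by omega) (mul_mem_map_C_pow I hδn hεn))
      -- `δ ≡ g (u δ - v ε)`
      have hδg : δ - g * (u * δ - v * ε) ∈ (I ^ (n + 2)).map (C : A →+* A[X]) := by
        have : δ - g * (u * δ - v * ε) = -(δ * (u * g + v * h - 1)) + v * (g * ε + h * δ) := by ring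
        rw [this]
        have huv1 : u * g + v * h - 1 ∈ (I ^ 1).map (C : A →+* A[X]) := by rwa [pow_one]
        exact Ideal.add_mem _ (neg_mem (mul_mem_map_C_pow (n := n + 1) (m := 1) I hδn huv1))
          (Ideal.mul_mem_left _ _ hsum)
      have hq : ∀ j, 0 ≤ j → (u * δ - v * ε).coeff j ∈ I ^ (n + 2) := by
        refine coeff_mem_of_coeff_monic_mul_mem _ hg 0 fun i hi => ?_
        have hpoly : g * (u * δ - v * ε) = δ - (δ - g * (u * δ - v * ε)) := by ring
        rw [hpoly, coeff_sub, hδdeg i (by omega), zero_sub]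
        exact neg_mem (Ideal.mem_map_C_iff.mp hδg i)
      have hδ' : δ ∈ (I ^ (n + 2)).map (C : A →+* A[X]) := by
        have : δ = (δ - g * (u * δ - v * ε)) + g * (u * δ - v * ε) := by ring
        rw [this]
        exact Ideal.add_mem _ hδg (Ideal.mul_mem_left _ _ (Ideal.mem_map_C_iff.mpr fun j =>
          hq j (Nat.zero_le j)))
      -- then `g ε ∈ I^{n+2}[X]`, so `ε ∈ I^{n+2}[X]`
      have hgε : g * ε ∈ (I ^ (n + 2)).map (C : A →+* A[X]) := by
        have : g * ε = (g * ε + h * δ) - h * δ := by ring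
        rw [this]
        exact Ideal.sub_mem _ hsum (Ideal.mul_mem_left _ _ hδ')
      have hε' : ε ∈ (I ^ (n + 2)).map (C : A →+* A[X]) :=
        Ideal.mem_map_C_iff.mpr fun j => coeff_mem_of_coeff_monic_mul_mem _ hg 0
          (fun i _ => Ideal.mem_map_C_iff.mp hgε i) j (Nat.zero_le j)
      exact ⟨hδ', hε'⟩
  have hzero : ∀ p : A[X], (∀ n, p ∈ (I ^ (n + 1)).map (C : A →+* A[X])) → p = 0 := by
    intro p hp
    refine Polynomial.ext fun j => ?_
    rw [coeff_zero]
    refine IsHausdorff.haus' (I := I) _ fun n => (smodEq_smul_top_iff _ _ _).mpr ?_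
    rw [sub_zero]
    exact Ideal.pow_le_pow_right (Nat.le_succ n) (Ideal.mem_map_C_iff.mp (hp n) j)
  have h1 : δ = 0 := hzero δ fun n => (key n).1
  have h2 : ε = 0 := hzero ε fun n => (key n).2
  rw [hδ, sub_eq_zero] at h1
  rw [hε, sub_eq_zero] at h2
  exact ⟨h1.symm, h2.symm⟩

end Uniqueness

/-! ### Corollary: adic Weierstrass preparation for polynomials -/

section Preparation

variable (I : Ideal A) [IsAdicComplete I A] [Nontrivial A]

/-- **Adic Weierstrass preparation for polynomials** (the case `h̄₀ =` unit constant of Hensel's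
lemma; e.g. the "`p`-adic Weierstrass preparation theorem" invoked by Blakestad–Grant 2023,
Prop. 7, to split the `p`-division polynomial over the `p`-complete ring `R̂`). Let `A` be
`I`-adically complete and `f ∈ A[X]` such that, modulo `I`, `f` has degree `k` with a unit
leading coefficient: `fᵢ ∈ I` for `i > k` and `f_k c' ≡ 1 (mod I)` for some `c'`. Then
`f = g h` with `g` monic of degree `k`, `g ≡ c'·(f₀ + ⋯ + f_k Xᵏ)`-normalised
(`g ≡ Xᵏ + ∑_{i<k} c' fᵢ Xⁱ (mod I)`), `h ≡ f_k (mod I)` a lift of the constant `f_k`, and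
`deg h ≤ deg f - k`. [cite: Bourbaki1989CommAlg, Ch. III §4 no. 3, Th. 1] -/
theorem exists_monic_mul_eq_of_coeff_mem (f : A[X]) (k : ℕ) (c' : A)
    (hc : f.coeff k * c' - 1 ∈ I) (htop : ∀ i, k < i → f.coeff i ∈ I) :
    ∃ g h : A[X], g.Monic ∧ g.natDegree = k ∧ h.natDegree ≤ f.natDegree - k ∧
      g - (X ^ k + ∑ i ∈ Finset.range k, C (c' * f.coeff i) * X ^ i) ∈ I.map (C : A →+* A[X]) ∧
      h - C (f.coeff k) ∈ I.map (C : A →+* A[X]) ∧ f = g * h := by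
  set r : A[X] := ∑ i ∈ Finset.range k, C (c' * f.coeff i) * X ^ i with hr
  set g₀ : A[X] := X ^ k + r with hg₀def
  have hrdeg : r.degree < (X ^ k : A[X]).degree := by
    rw [degree_X_pow]
    refine (degree_sum_le _ _).trans_lt ((Finset.sup_lt_iff (WithBot.bot_lt_coe k)).mpr ?_)
    intro i hi
    refine (degree_C_mul_X_pow_le _ _).trans_lt ?_
    exact WithBot.coe_lt_coe.mpr (Finset.mem_range.mp hi)
  have hg₀ : g₀.Monic := (monic_X_pow k).add_of_left hrdeg
  have hg₀deg : g₀.natDegree = k := by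
    rw [hg₀def, natDegree_add_eq_left_of_degree_lt hrdeg, natDegree_X_pow]
  have hg₀coeff : ∀ i, g₀.coeff i = if i = k then 1 else if i < k then c' * f.coeff i else 0 := by
    intro i
    rw [hg₀def, coeff_add, coeff_X_pow, hr, coeff_sum_C_mul_X_pow]
    split_ifs with h1 h2 <;> first | omega | ring
  have hf : f - g₀ * C (f.coeff k) ∈ I.map (C : A →+* A[X]) := by
    refine Ideal.mem_map_C_iff.mpr fun i => ?_
    rw [coeff_sub, coeff_mul_C, hg₀coeff]
    split_ifs with h1 h2
    · subst h1; rw [one_mul, sub_self]; exact I.zero_mem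
    · have : f.coeff i - c' * f.coeff i * f.coeff k = -(f.coeff i * (f.coeff k * c' - 1)) := by ring
      rw [this]; exact neg_mem (I.mul_mem_left _ hc)
    · rw [zero_mul, sub_zero]; exact htop i (by omega)
  have huv : (0 : A[X]) * g₀ + C c' * C (f.coeff k) - 1 ∈ I.map (C : A →+* A[X]) := by
    rw [zero_mul, zero_add, ← C_mul, ← C_1, ← C_sub, mul_comm]
    exact Ideal.mem_map_of_mem _ hc
  obtain ⟨g, h, hg, hgdeg, hhdeg, hgg₀, hhh₀, hfgh⟩ :=
    exists_monic_mul_eq I f 0 (C c') g₀ (C (f.coeff k)) hg₀ hf huv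
  refine ⟨g, h, hg, by rw [hgdeg, hg₀deg], by rwa [hg₀deg] at hhdeg, hgg₀, hhh₀, hfgh⟩

end Preparation

end Literature.RingTheory.HenselLemma
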